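import Summits.AtomisticToContinuum.HydrodynamicLimit.Theorems.ImplosionDichotomyPolynomialCompressionEosRatioAnalytic
import Summits.AtomisticToContinuum.HydrodynamicLimit.Theorems.ImplosionDichotomyHsEosLowDensity
import Literature.MathematicalPhysics.KineticTheory.HardSphereEulerLocalTheoryProofs
import HarnessLib

/-!
# EOS consistency of the activity inversion (stub `stub_eos`)

Crux `Summit.AtomisticToContinuum.HydrodynamicLimit.Theses.OneFlightGossipEngine.ClampedCurrentsDock`
(stmt-AtomisticToContinuum-14680), line `IdeatorTwoSketch`, stub `stub_eos : EosConsistency` — the one static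
thermodynamic identity the Euler cancellation of Yau's relative-entropy clock needs: the insertion factor `Rf`
of the activity inversion (`a = ρ · Rf(σ³ρ)`, `Rf x · Φ(x Rf x) = 1`, `Φ(u) = Σ_j bE j uʲ/j!`) is the
exponential of the CANONICAL excess chemical potential, `log Rf = F + ηF′` near `η = 0⁺` with `F` the analytic
germ of `hsExcessFreeEnergy`, hence `(log Rf)′(η) = 2F′(η) + ηF″(η)`. `EosConsistency` is re-declared verbatim
from the line skeleton `Cruxes/ClampedCurrentsDock/Lines/IdeatorTwoSketch.lean`.

## Proof

The tree's proof of `HsEosLowDensity` (`Theorems/ImplosionDichotomyHsEosLowDensity`) already CONSTRUCTS the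
canonical free energy from the insertion factor: with `Rf₀` the analytic insertion factor of
`stub_eosRatioAnalytic` (E1), the uniform convergence of the insertion ratios (`stub_eosRatioUniform`, E2a) and
the telescoping/Riemann-sum step (`stub_eosCesaro`, E2b) give
`−N⁻¹ log hsFreeVolume η N → ∫₀¹ log Rf₀(ηs) ds` on `[0, η₂)`, so that `hsExcessFreeEnergy η = F η` there with
`F η := ∫₀¹ log Rf₀(ηs) ds`, and `F` is a real power series near `0`
(`hasFPowerSeriesOnBall_intervalIntegral_comp_mul`, E3). Then `η F(η) = ∫₀^η log Rf₀` (substitution), whose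
derivative on `(0, η₁)` is `log Rf₀(η)` (FTC) and also `F(η) + ηF′(η)` (product rule): `log Rf₀ = F + ηF′` on
`(0, η₁)`; differentiating once more, `(log Rf₀)′ = 2F′ + ηF″`. Finally ANY insertion factor `Rf` handed over
with the uniqueness clause (the only root of `R · Φ(xR) = 1` in `[1/2, 2]` is `Rf x`) coincides with `Rf₀` on
`(0, η₁)` (`1 ≤ Rf₀ ≤ 2` solves the same equation there), so the identity transfers to `Rf`.
-/

noncomputable section

open Set MeasureTheory Filter Topology
open scoped ENNReal NNReal
open Literature.MathematicalPhysics.KineticTheory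

namespace Summit.AtomisticToContinuum.HydrodynamicLimit.Theorems.ClampedCurrentsDockEos

/-! ## The statement (verbatim from the line skeleton) -/

/-- **S4 — EOS consistency of the activity inversion (static).** For every insertion factor `Rf` on `(−r,r)`
with the four defining properties of `stub_eosRatioAnalytic`, near `η = 0` the function `log Rf` is the
canonical excess chemical potential: there are `η₁ ∈ (0, r]` and a real-analytic `F` agreeing with
`hsExcessFreeEnergy` on `[0, η₁)` such that `log Rf` is differentiable on `(0, η₁)` with
`(log Rf)′(η) = 2F′(η) + ηF″(η) = (d/dη)(F + ηF′)`. Equivalently `ρ ∂_ρ log(ρ Rf(σ³ρ)) = Z + ηZ′`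
(`Z = hsCompressibility = 1 + ηF′`, `hsCompressibility_eq`), which kills the activity bracket of S3 for the
reference family `a_s = ρ_s Rf(σ³ρ_s)` and turns its order-zero term into `−ηZ′ div u`. First-order check in
the tree: `Rf 0 = 1`, `Rf′(0) = 4π/3 = 2F′(0)`. (Low-density equivalence of the activity (Mayer) and
canonical (Helmholtz) expansions; Ruelle 1969 §4, Lebowitz–Penrose 1964, Pulvirenti–Tsagkarogiannis 2012.) -/
def EosConsistency : Prop :=
  ∀ (r : ℝ) (Rf : ℝ → ℝ), 0 < r →
    (∀ x ∈ Ioo (-r) r, 0 < Rf x ∧ Rf x * (∑' j : ℕ, bE j / (j.factorial : ℝ) * (x * Rf x) ^ j) = 1) →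
    (∀ x ∈ Icc 0 r, 1 ≤ Rf x ∧ Rf x ≤ 2) → ContinuousOn Rf (Icc 0 r) →
    (∀ x ∈ Ioo (-r) r, ∀ R ∈ Icc (1 / 2 : ℝ) 2,
      R * (∑' j : ℕ, bE j / (j.factorial : ℝ) * (x * R) ^ j) = 1 → R = Rf x) →
    ∃ η₁ : ℝ, 0 < η₁ ∧ η₁ ≤ r ∧ ∃ F : ℝ → ℝ, AnalyticOnNhd ℝ F (Ioo (-η₁) η₁) ∧
      EqOn hsExcessFreeEnergy F (Ico 0 η₁) ∧
      ∀ η ∈ Ioo 0 η₁, DifferentiableAt ℝ (fun x => Real.log (Rf x)) η ∧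
        deriv (fun x => Real.log (Rf x)) η = 2 * deriv F η + η * deriv (deriv F) η

/-! ## The canonical free energy built from the tree's insertion factor -/

/-- **The canonical free energy from the insertion factor.** With `Rf₀` the analytic insertion factor of
`stub_eosRatioAnalytic` there are `r₀ > 0` and `η₂ ∈ (0, r₀]` such that: `Rf₀` has a power series at `0`,
`Rf₀ 0 = 1`, `Rf₀` solves `Rf₀ x · Φ(x Rf₀ x) = 1` on `(−r₀, r₀)`, `1 ≤ Rf₀ ≤ 2` and `Rf₀` is continuous on
`[0, r₀]`, and the canonical thermodynamic limit is `−N⁻¹ log hsFreeVolume η N → ∫₀¹ log Rf₀(ηs) ds` for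
`η ∈ [0, η₂)` (glue of E1, E2a, E2b exactly as in `hsEosLowDensity_proof`). -/
theorem exists_insertionFactor_freeEnergy :
    ∃ r₀ : ℝ, 0 < r₀ ∧ ∃ Rf₀ : ℝ → ℝ,
      (∃ p : FormalMultilinearSeries ℝ ℝ ℝ, HasFPowerSeriesOnBall Rf₀ p 0 (ENNReal.ofReal r₀)) ∧
      Rf₀ 0 = 1 ∧
      (∀ x ∈ Ioo (-r₀) r₀, 0 < Rf₀ x ∧
        Rf₀ x * (∑' j : ℕ, bE j / (j.factorial : ℝ) * (x * Rf₀ x) ^ j) = 1) ∧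
      (∀ x ∈ Icc 0 r₀, 1 ≤ Rf₀ x ∧ Rf₀ x ≤ 2) ∧ ContinuousOn Rf₀ (Icc 0 r₀) ∧
      ∃ η₂ : ℝ, 0 < η₂ ∧ η₂ ≤ r₀ ∧
        ∀ η ∈ Ico 0 η₂, Tendsto (fun N : ℕ => -(N : ℝ)⁻¹ * Real.log (hsFreeVolume η N)) atTop
          (𝓝 (∫ s in (0 : ℝ)..1, Real.log (Rf₀ (η * s)))) := by
  obtain ⟨r, hr, Rf, hps, h0, -, hsol, hbd, hLip, -⟩ := stub_eosRatioAnalytic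
  have hsol' : ∀ x ∈ Icc 0 (r / 2), 1 ≤ Rf x ∧ Rf x ≤ 2 ∧
      Rf x * (∑' j : ℕ, bE j / (j.factorial : ℝ) * (x * Rf x) ^ j) = 1 := by
    intro x hx
    have hx' : x ∈ Icc 0 r := ⟨hx.1, hx.2.trans (by linarith)⟩
    have hxo : x ∈ Ioo (-r) r := ⟨by linarith [hx.1], by linarith [hx.2]⟩
    exact ⟨(hbd x hx').1, (hbd x hx').2, (hsol x hxo).2⟩
  have hLip' : ∃ L : NNReal, LipschitzOnWith L Rf (Icc 0 (r / 2)) := by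
    obtain ⟨L, hL⟩ := hLip
    exact ⟨L, hL.mono (Icc_subset_Icc le_rfl (by linarith))⟩
  obtain ⟨η₂, hη₂, hη₂r, hunif⟩ := stub_eosRatioUniform Rf (r / 2) (by positivity) hsol' hLip'
  have hcont : ContinuousOn Rf (Icc 0 r) := by
    obtain ⟨L, hL⟩ := hLip
    exact hL.continuousOn
  have hcont' : ContinuousOn Rf (Icc 0 (r / 2)) := hcont.mono (Icc_subset_Icc le_rfl (by linarith))
  have hbd' : ∀ x ∈ Icc 0 (r / 2), 1 ≤ Rf x ∧ Rf x ≤ 2 := fun x hx => ⟨(hsol' x hx).1, (hsol' x hx).2.1⟩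
  refine ⟨r, hr, Rf, hps, h0, hsol, hbd, hcont, η₂, hη₂, hη₂r.trans (by linarith), fun η hη => ?_⟩
  refine stub_eosCesaro Rf (r / 2) (by positivity) hcont' hbd' h0 η hη.1 (hη.2.trans_le hη₂r) ?_
  intro hηpos δ hδ
  exact hunif η ⟨hηpos, hη.2⟩ δ hδ

/-- **`log Rf₀ = F + ηF′` on `(0, η₁)`.** If `Rf₀` is continuous with `1 ≤ Rf₀` on `[0, r₀]` and
`F η = ∫₀¹ log Rf₀(ηs) ds` is differentiable at `η ∈ (0, r₀)`, then `log Rf₀ η = F η + η F′(η)`: both sides are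
the derivative at `η` of `y ↦ y F(y) = ∫₀^y log Rf₀` (substitution; FTC for the continuous integrand, product
rule). [folklore] -/
theorem log_eq_add_mul_deriv {Rf₀ F : ℝ → ℝ} {r₀ η : ℝ} (hcont : ContinuousOn Rf₀ (Icc 0 r₀))
    (hbd : ∀ x ∈ Icc 0 r₀, 1 ≤ Rf₀ x) (hF : ∀ y, F y = ∫ s in (0 : ℝ)..1, Real.log (Rf₀ (y * s)))
    (hη : η ∈ Ioo 0 r₀) (hFd : DifferentiableAt ℝ F η) :
    Real.log (Rf₀ η) = F η + η * deriv F η := by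
  -- `y F(y) = ∫₀^y log Rf₀`
  have hHF : (fun y => y * F y) = fun y => ∫ t in (0 : ℝ)..y, Real.log (Rf₀ t) := by
    funext y
    have h := intervalIntegral.mul_integral_comp_mul_left (f := fun t => Real.log (Rf₀ t))
      (a := (0 : ℝ)) (b := 1) y
    simp only [mul_zero, mul_one] at h
    rw [hF y]
    exact h
  -- `log ∘ Rf₀` is continuous on `[0, r₀]`
  have hlog : ContinuousOn (fun t => Real.log (Rf₀ t)) (Icc 0 r₀) :=
    hcont.log fun x hx => by linarith [hbd x hx]
  have hηI : Icc 0 r₀ ∈ 𝓝 η := Icc_mem_nhds hη.1 hη.2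
  -- FTC
  have h1 : HasDerivAt (fun y => y * F y) (Real.log (Rf₀ η)) η := by
    rw [hHF]
    refine intervalIntegral.integral_hasDerivAt_right ?_ ?_ (hlog.continuousAt hηI)
    · refine (hlog.mono ?_).intervalIntegrable
      rw [uIcc_of_le hη.1.le]
      exact Icc_subset_Icc le_rfl hη.2.le
    · exact ContinuousOn.stronglyMeasurableAtFilter isOpen_Ioo
        (hlog.mono Ioo_subset_Icc_self) η ⟨hη.1, hη.2⟩
  -- product rule
  have h2 : HasDerivAt (fun y => y * F y) (1 * F η + η * deriv F η) η :=
    (hasDerivAt_id η).mul hFd.hasDerivAt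
  have := h1.unique h2
  rw [this, one_mul]

/-! ## The stub -/

/-- **STUB `stub_eos`** of line `IdeatorTwoSketch` (crux `ClampedCurrentsDock`, stmt-AtomisticToContinuum-14680):
EOS consistency of the activity inversion, `(log Rf)′(η) = 2F′(η) + ηF″(η)` on `(0, η₁)` with `F` the analytic
germ of `hsExcessFreeEnergy` built from the tree's insertion factor (`F η = ∫₀¹ log Rf₀(ηs) ds`) and `Rf = Rf₀`
there by uniqueness of the root. [cite: Ruelle1969, §3.4] -/
theorem stub_eos : EosConsistency := by
  intro r Rf hr _hsol _hbd _hcont huniq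
  obtain ⟨r₀, hr₀, Rf₀, ⟨p, hp⟩, h0, hsol₀, hbd₀, hcont₀, η₂, hη₂, hη₂r₀, hlim⟩ :=
    exists_insertionFactor_freeEnergy
  -- `log ∘ Rf₀` is analytic at `0`: power series `q` on a ball of radius `> ρ₁ > 0`
  have hRf₀a : AnalyticAt ℝ Rf₀ 0 := hp.analyticAt
  have hRf₀0 : 0 < Rf₀ 0 := by
    rw [h0]
    exact one_pos
  obtain ⟨q, ρ, hq⟩ := hRf₀a.log hRf₀0
  obtain ⟨ρ₁, hρ₁0, hρ₁⟩ : ∃ ρ₁ : ℝ, 0 < ρ₁ ∧ ENNReal.ofReal ρ₁ < ρ := by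
    obtain ⟨ρ₁, -, h1, h2⟩ := ENNReal.lt_iff_exists_real_btwn.1 hq.r_pos
    exact ⟨ρ₁, ENNReal.ofReal_pos.1 h1, h2⟩
  -- the radius `η₁ := min (min r η₂) ρ₁`
  set η₁ : ℝ := min (min r η₂) ρ₁ with hη₁_def
  have hη₁0 : 0 < η₁ := lt_min (lt_min hr hη₂) hρ₁0
  have hη₁r : η₁ ≤ r := (min_le_left _ _).trans (min_le_left _ _)
  have hη₁₂ : η₁ ≤ η₂ := (min_le_left _ _).trans (min_le_right _ _)
  have hη₁ρ : η₁ ≤ ρ₁ := min_le_right _ _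
  have hq' : HasFPowerSeriesOnBall (fun x => Real.log (Rf₀ x)) q 0 (ENNReal.ofReal η₁) :=
    hq.mono (ENNReal.ofReal_pos.2 hη₁0) ((ENNReal.ofReal_le_ofReal hη₁ρ).trans hρ₁.le)
  -- the canonical free energy `F η := ∫₀¹ log Rf₀(ηs) ds` and its power series on the ball of radius `η₁`
  have hF := hasFPowerSeriesOnBall_intervalIntegral_comp_mul hq'
  set F : ℝ → ℝ := fun η => ∫ s in (0 : ℝ)..1, Real.log (Rf₀ (η * s)) with hF_def
  have hFan : AnalyticOnNhd ℝ F (Ioo (-η₁) η₁) := by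
    have := hF.analyticOnNhd
    rwa [Metric.eball_ofReal, Real.ball_eq_Ioo, zero_sub, zero_add] at this
  refine ⟨η₁, hη₁0, hη₁r, F, hFan, fun η hη => ?_, fun η hη => ?_⟩
  · -- agreement with `hsExcessFreeEnergy` (a `limsup`) on `[0, η₁)`
    unfold hsExcessFreeEnergy
    exact (hlim η ⟨hη.1, hη.2.trans_le hη₁₂⟩).limsup_eq
  · -- the identity at `η ∈ (0, η₁)`
    have hη₁r₀ : η₁ ≤ r₀ := hη₁₂.trans hη₂r₀
    -- `Rf = Rf₀` on the open neighbourhood `(0, η₁)` of `η` (uniqueness of the root in `[1/2, 2]`)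
    have hagree : ∀ x ∈ Ioo 0 η₁, Rf x = Rf₀ x := by
      intro x hx
      have hxr : x ∈ Ioo (-r) r := ⟨by linarith [hx.1], hx.2.trans_le hη₁r⟩
      have hxc₀ : x ∈ Icc 0 r₀ := ⟨hx.1.le, hx.2.le.trans hη₁r₀⟩
      have hxo₀ : x ∈ Ioo (-r₀) r₀ := ⟨by linarith [hx.1], hx.2.trans_le hη₁r₀⟩
      exact (huniq x hxr (Rf₀ x) ⟨by linarith [(hbd₀ x hxc₀).1], (hbd₀ x hxc₀).2⟩ (hsol₀ x hxo₀).2).symm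
    -- `log Rf₀ = F + yF′` on `(0, η₁)`
    have hlogeq : ∀ y ∈ Ioo 0 η₁, Real.log (Rf₀ y) = F y + y * deriv F y := by
      intro y hy
      have hy' : y ∈ Ioo (-η₁) η₁ := ⟨by linarith [hy.1], hy.2⟩
      exact log_eq_add_mul_deriv hcont₀ (fun x hx => (hbd₀ x hx).1) (fun _ => rfl)
        ⟨hy.1, hy.2.trans_le hη₁r₀⟩ (hFan y hy').differentiableAt
    -- so `log ∘ Rf = F + (·)F′` near `η`
    have hmem : Ioo 0 η₁ ∈ 𝓝 η := isOpen_Ioo.mem_nhds hη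
    have hev : (fun y => F y + y * deriv F y) =ᶠ[𝓝 η] fun x => Real.log (Rf x) := by
      filter_upwards [hmem] with y hy
      rw [hagree y hy, hlogeq y hy]
    -- differentiate `F + (·)F′` at `η`
    have hη' : η ∈ Ioo (-η₁) η₁ := ⟨by linarith [hη.1], hη.2⟩
    have hFd : HasDerivAt F (deriv F η) η := (hFan η hη').differentiableAt.hasDerivAt
    have hF'd : HasDerivAt (deriv F) (deriv (deriv F) η) η :=
      (hFan.deriv η hη').differentiableAt.hasDerivAt
    have hsum : HasDerivAt (fun y => F y + y * deriv F y)
        (deriv F η + (1 * deriv F η + η * deriv (deriv F) η)) η :=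
      hFd.add ((hasDerivAt_id η).mul hF'd)
    have hfin : HasDerivAt (fun x => Real.log (Rf x))
        (deriv F η + (1 * deriv F η + η * deriv (deriv F) η)) η :=
      hsum.congr_of_eventuallyEq hev.symm
    refine ⟨hfin.differentiableAt, ?_⟩
    rw [hfin.deriv]
    ring

end Summit.AtomisticToContinuum.HydrodynamicLimit.Theorems.ClampedCurrentsDockEos

end
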